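import Literature.NumberTheory.Automorphic.AutomorphicGaloisConj
import Literature.NumberTheory.Automorphic.AutomorphicTwistNorm
import HarnessLib

/-!
# The idele norm is Galois invariant: `‖σ x‖_𝔸 = ‖x‖_𝔸` (pure proofs)

Topic `NumberTheory/Automorphic`; theorems only (no definition, no named fact). For a number
field `K`, `σ ∈ Aut(K/F)` acting on the adele ring `𝔸_K` (`GaloisActionAdeleRing`: componentwise,
`L_w → L_{σ w}` on the completions) and an idele `x`, the idele norm
(`Literature.NumberTheory.GaloisRepresentations.ideleNorm`,
`‖x‖ = ∏_{w ∣ ∞} ‖x_w‖^{[K_w : ℝ]} · ∏_{v ∤ ∞} ‖x_v‖_v`) satisfies `‖σ x‖ = ‖x‖`: the factors are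
permuted, `‖(σ x)_{σ w}‖ = ‖x_w‖` (`InfiniteAdeleRing.norm_smul_apply_smul`;
`valued_galAdicCompletionMap` with `N(σ v) = N v`, `HeightOneSpectrum.absNorm_algEquiv_smul`) and
`[K_{σ w} : ℝ] = [K_w : ℝ]` (`InfinitePlace.isReal_smul_iff`). Cassels–Fröhlich, *Algebraic Number
Theory* (1967), Ch. II §16 (the idele "content"/module is defined by the product of normalised
absolute values and is invariant under automorphisms, which permute them) and Ch. VII §1.1
(`|σ a|_{σ w} = |a|_w`).

Consequences for `GL_n(𝔸_K)` (entrywise action of `AutomorphicGaloisConj`):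
`‖det (σ g)‖ = ‖det g‖` and hence `(‖·‖^s ∘ det)(σ g) = (‖·‖^s ∘ det)(g)` for the norm-power
Hecke characters (`detTwist n χ`, `χ = ‖·‖_𝔸^s`) — the input that makes the character
`χ ψ ψ^σ` of the twist `π ⊗ ψ∘det` of an essentially `σ`-conjugate self-dual `(π, χ)`
(`EssConjSelfDualTwistProofs`) explicit for norm powers.

## References

* J. W. S. Cassels, A. Fröhlich (eds.), *Algebraic Number Theory* (1967), Ch. II §16, Ch. VII
  §1.1. [CasselsFrohlichANT1967]
-/

noncomputable section

open scoped MatrixGroups Classical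
open NumberField IsDedekindDomain

namespace Literature.NumberTheory.Automorphic

open Literature.NumberTheory.GaloisRepresentations (HeckeCharacter ideleGroup ideleNorm)

variable (F : Type*) [Field F] {K : Type} [Field K] [NumberField K] [Algebra F K]

/-- **The idele norm is Galois invariant**: `‖σ • x‖_𝔸 = ‖x‖_𝔸` for `σ ∈ Aut(K/F)` and an idele
`x` of `K` (the action of `GaloisActionAdeleRing` on `𝔸_K`, pushed to the units). Both the
archimedean and the finite factors are permuted by `w ↦ σ w`, with `‖(σ x)_{σ w}‖ = ‖x_w‖` and
equal local degrees / residue cardinalities. [cite: CasselsFrohlichANT1967, Ch. VII §1.1] -/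
theorem ideleNorm_unitsMap_galRingHom (σ : K ≃ₐ[F] K) (x : ideleGroup K) :
    ideleNorm (Units.map (MulSemiringAction.toRingHom (K ≃ₐ[F] K) (AdeleRing (𝓞 K) K) σ :
        AdeleRing (𝓞 K) K →* AdeleRing (𝓞 K) K) x) = ideleNorm x := by
  have hx : ((Units.map (MulSemiringAction.toRingHom (K ≃ₐ[F] K) (AdeleRing (𝓞 K) K) σ :
      AdeleRing (𝓞 K) K →* AdeleRing (𝓞 K) K) x : (AdeleRing (𝓞 K) K)ˣ) : AdeleRing (𝓞 K) K) =
        σ • (x : AdeleRing (𝓞 K) K) := rfl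
  simp only [ideleNorm, hx, AdeleRing.smul_fst, AdeleRing.smul_snd]
  congr 1
  · -- archimedean factors: reindex by `w ↦ σ • w`
    refine (Fintype.prod_equiv (MulAction.toPerm σ) _ _ fun w => ?_).symm
    have hmult : (σ • w).mult = w.mult := by
      simp only [InfinitePlace.mult, InfinitePlace.isReal_smul_iff]
    rw [MulAction.toPerm_apply, InfiniteAdeleRing.norm_smul_apply_smul, hmult]
  · -- finite factors: reindex by `v ↦ σ • v`
    refine (finprod_eq_of_bijective (fun v : HeightOneSpectrum (𝓞 K) => σ • v)
      (MulAction.bijective σ) fun v => ?_).symm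
    rw [FiniteAdeleRing.smul_apply_smul, FinitePlace.norm_def, FinitePlace.norm_def,
      valued_galAdicCompletionMap]
    have h : (Ideal.absNorm (σ • v).asIdeal : NNReal) = Ideal.absNorm v.asIdeal := by
      rw [HeightOneSpectrum.absNorm_algEquiv_smul F σ v]
    simp only [h]

/-- **`‖det (σ g)‖_𝔸 = ‖det g‖_𝔸`** for `g ∈ GL_n(𝔸_K)` and the entrywise action of `σ`
(`det (σ g) = σ (det g)`, Mathlib `Matrix.GeneralLinearGroup.map_det`).
[cite: CasselsFrohlichANT1967, Ch. VII §1.1] -/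
theorem ideleNorm_det_smul {n : ℕ} (σ : K ≃ₐ[F] K) (g : GL (Fin n) (AdeleRing (𝓞 K) K)) :
    ideleNorm (Matrix.GeneralLinearGroup.det (σ • g)) = ideleNorm (Matrix.GeneralLinearGroup.det g) := by
  rw [GeneralLinearGroup.smul_def, Matrix.GeneralLinearGroup.map_det]
  exact ideleNorm_unitsMap_galRingHom F σ _

/-- **The norm-power characters `‖·‖^s ∘ det` of `GL_n(𝔸_K)` are `Aut(K/F)`-invariant**:
`(‖·‖^s ∘ det)(σ g) = (‖·‖^s ∘ det)(g)` (`detTwist n χ` for `χ = ‖·‖_𝔸^s`, typed on the adelic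
group datum as in `IsGalConjEssSelfDual`). [cite: CasselsFrohlichANT1967, Ch. VII §1.1] -/
theorem detTwist_smul_of_cpow {n : ℕ} {χ : HeckeCharacter K} {s : ℂ}
    (hχ : ∀ x : ideleGroup K, ((χ x : ℂˣ) : ℂ) = (ideleNorm x : ℂ) ^ s) (σ : K ≃ₐ[F] K)
    (g : (AdelicGroupData.gl n K).Adelic) : detTwist n χ (σ • g) = detTwist n χ g := by
  refine Units.ext ?_
  rw [detTwist_apply', detTwist_apply', hχ, hχ]
  congr 2
  exact ideleNorm_det_smul F σ _

end Literature.NumberTheory.Automorphic
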